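import Literature.MathematicalPhysics.QuantumLattice.DWaveSourceFreePressure
import Literature.MathematicalPhysics.QuantumLattice.DWaveSourceProofs
import Literature.MathematicalPhysics.QuantumLattice.LiebFluxPhaseProofs
import Literature.MathematicalPhysics.QuantumLattice.HubbardFreeTorusGroundEnergy

/-!
# Route `WeakCouplingBCS`, support item `WcbcsSourcedFreeGasCooperLog`
# (stmt-HubbardSuperconductivity-1210): the BdG lower bound for the free gas with a pair source

For the `U = 0` Hubbard torus `(ℤ/Lℤ)²` (hopping `1`, chemical potential `μ`, `L ≥ 3`) with the pair
source `-h(Δ_g + Δ_g†)` of an ARBITRARY real form factor `g` (`Δ_g = pairField g L`) we PROVE the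
operator lower bound on all of Fock space

  `⟨φ, (K_μ - h(Δ_g + Δ_g†)) φ⟩ ≥ Σ_k (ξ_k - √(ξ_k² + h² w_g(k)²))`   (`‖φ‖ = 1`),

`K_μ = hubbardTorusWith 2 L 1 0 μ`, `ξ_k = ε_L(k) - μ`, `w_g = pairFieldMode g L` (the real momentum
profile of `Δ_g = -Σ_k w_g(k) b_k`, `pairField_eq_neg_sum_pairFieldMode_smul_pairMode`).

Proof: in momentum space `K_μ - h(Δ_g + Δ_g†) = Σ_k [ξ_k (n_{k↑} + n_{k↓}) + h w_g(k) (b_k + b_k†)]`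
(`sourcedFreeTorus_eq_sum`); exactly as for the `d`-wave source (`DWaveSourceFreePressure.lean`) the
Bogoliubov implementer of `(x,↑) ↦ (k_x,↑)`, `(x,↓) ↦ (-k_x,↓)` conjugates independent on-site BdG
blocks into it, so `Tr e^{-βH} = 2^{2L²} Π_k e^{-βξ_k}(1 + cosh βE_k)/2`, `E_k = √(ξ_k² + h²w_g(k)²)`
(`partitionFn_sourcedFreeTorus_re`); with `e^{-βE₀} ≤ Re Z_β` and `(1 + cosh y)/2 ≤ e^y` this gives
`E₀ ≥ Σ_k (ξ_k - E_k) - 2L² log 2/β` for every `β > 0`, hence `E₀ ≥ Σ_k (ξ_k - E_k)`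
(`sum_bdgLevel_le_groundEnergy_sourcedFreeTorus`), and the variational principle finishes
(`sum_bdgLevel_le_re_rayleigh_sourcedFreeTorus`).

Sources: J. Bardeen, L. N. Cooper, J. R. Schrieffer, Phys. Rev. 108 (1957) 1175 §III; P. G. de Gennes,
*Superconductivity of Metals and Alloys* (1966) Ch. 5; J. von Delft, D. C. Ralph, Phys. Rep. 345 (2001)
61 §4.2. No definition, no named fact.
-/

noncomputable section

namespace Summit.HubbardSuperconductivity.HubbardSuperconductivity.Theorems

open Matrix Finset Literature.MathematicalPhysics.QuantumLattice Literature.Probability.LatticeModels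
open scoped ComplexConjugate

variable {L : ℕ} [NeZero L]

/-! ### The sourced free Hamiltonian in momentum space -/

/-- **`K_μ - h(Δ_g + Δ_g†)` in momentum space** (`L ≥ 3`): for every real form factor `g`,
`hubbardTorusWith 2 L 1 0 μ - h(Δ_g + Δ_g†) = Σ_k [ξ_k (n_{k↑} + n_{k↓}) + h w_g(k) (b_k + b_k†)]`,
`ξ_k = ε_L(k) - μ`, `w_g = pairFieldMode g L`, `b_k = c_{-k↓}c_{k↑}`. [folklore] -/
theorem sourcedFreeTorus_eq_sum (hL : 3 ≤ L) (g : Site 2 → ℝ) (μ h : ℝ) :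
    hubbardTorusWith 2 L 1 0 μ - (h : ℂ) • (pairField g L + (pairField g L)ᴴ) =
      ∑ k : TorusSite 2 L,
        (((torusBand L k - μ : ℝ) : ℂ) • (momentumNumber k 0 + momentumNumber k 1) +
          ((h * pairFieldMode g L k : ℝ) : ℂ) • (pairMode k + (pairMode k)ᴴ)) := by
  have hkin : hubbardTorusWith 2 L 1 0 μ =
      ∑ k : TorusSite 2 L, ((torusBand L k - μ : ℝ) : ℂ) • (momentumNumber k 0 + momentumNumber k 1) := by
    rw [hubbardTorusWith_zero_eq_sum_momentumNumber hL μ]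
    refine Finset.sum_congr rfl fun k _ => ?_
    rw [Fin.sum_univ_two, smul_add]
  have hsrc : pairField g L + (pairField g L)ᴴ =
      -∑ k : TorusSite 2 L, ((pairFieldMode g L k : ℝ) : ℂ) • (pairMode k + (pairMode k)ᴴ) := by
    rw [pairField_eq_neg_sum_pairFieldMode_smul_pairMode, conjTranspose_neg, conjTranspose_sum, ← neg_add,
      ← Finset.sum_add_distrib]
    congr 1
    refine Finset.sum_congr rfl fun k _ => ?_
    rw [conjTranspose_smul, Complex.star_def, Complex.conj_ofReal, smul_add]
  have hcoef : ∀ k : TorusSite 2 L, (h : ℂ) * ((pairFieldMode g L k : ℝ) : ℂ) =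
      ((h * pairFieldMode g L k : ℝ) : ℂ) := fun k => by push_cast; ring
  rw [hkin, hsrc, smul_neg, sub_neg_eq_add, Finset.smul_sum, ← Finset.sum_add_distrib]
  refine Finset.sum_congr rfl fun k _ => ?_
  rw [smul_smul, hcoef]

/-- **The on-site BdG blocks are conjugate to the sourced free Hamiltonian** (`L ≥ 3`): with the
implementer of `exists_bdg_implementer`,
`W (Σ_x [ξ_{k_x}(n_{x↑}+n_{x↓}) + h w_g(k_x)(c_{x↓}c_{x↑} + h.c.)]) W' = K_μ - h(Δ_g + Δ_g†)`.
[folklore] -/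
theorem exists_conj_onSiteBdG_eq_sourcedFreeTorus (hL : 3 ≤ L) (g : Site 2 → ℝ) (μ h : ℝ) :
    ∃ W W' : Matrix (Finset (Orb (FermionTorus 2 L))) (Finset (Orb (FermionTorus 2 L))) ℂ,
      W' * W = 1 ∧
      W * (∑ x : FermionTorus 2 L,
        (((torusBand L x.toTorusSite - μ : ℝ) : ℂ) • (numberOp x 0 + numberOp x 1) +
          ((h * pairFieldMode g L x.toTorusSite : ℝ) : ℂ) •
            (annihilation (orb x 1) * annihilation (orb x 0) +
              (annihilation (orb x 1) * annihilation (orb x 0))ᴴ))) * W' =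
      hubbardTorusWith 2 L 1 0 μ - (h : ℂ) • (pairField g L + (pairField g L)ᴴ) := by
  obtain ⟨W, W', h1, _h2, ha0, ha1, hc0, hc1⟩ := exists_bdg_implementer (L := L)
  refine ⟨W, W', h1, ?_⟩
  have hnum : ∀ (x : FermionTorus 2 L), W * (numberOp x 0 + numberOp x 1) * W' =
      momentumNumber x.toTorusSite 0 + momentumNumber (-x.toTorusSite) 1 := by
    intro x
    rw [mul_add, add_mul, numberOp, numberOp, conj_mul_of_mul_eq_one h1, conj_mul_of_mul_eq_one h1,
      hc0, ha0, hc1, ha1, momentumNumber, momentumNumber]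
  have hpair : ∀ (x : FermionTorus 2 L),
      W * (annihilation (orb x 1) * annihilation (orb x 0) + (annihilation (orb x 1) * annihilation (orb x 0))ᴴ) * W' =
      pairMode x.toTorusSite + (pairMode x.toTorusSite)ᴴ := by
    intro x
    rw [pairMode_conjTranspose, pairMode, mul_add, add_mul, conjTranspose_mul, annihilation_conjTranspose,
      annihilation_conjTranspose, conj_mul_of_mul_eq_one h1, conj_mul_of_mul_eq_one h1, ha1, ha0, hc0, hc1]
  have hsum : W * (∑ x : FermionTorus 2 L,
        (((torusBand L x.toTorusSite - μ : ℝ) : ℂ) • (numberOp x 0 + numberOp x 1) +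
          ((h * pairFieldMode g L x.toTorusSite : ℝ) : ℂ) •
            (annihilation (orb x 1) * annihilation (orb x 0) +
              (annihilation (orb x 1) * annihilation (orb x 0))ᴴ))) * W' =
      ∑ x : FermionTorus 2 L,
        (((torusBand L x.toTorusSite - μ : ℝ) : ℂ) •
            (momentumNumber x.toTorusSite 0 + momentumNumber (-x.toTorusSite) 1) +
          ((h * pairFieldMode g L x.toTorusSite : ℝ) : ℂ) •
            (pairMode x.toTorusSite + (pairMode x.toTorusSite)ᴴ)) := by
    rw [conj_sum_smul_add_smul]
    exact Finset.sum_congr rfl fun x _ => by rw [hnum, hpair]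
  rw [hsum, sourcedFreeTorus_eq_sum hL g μ h]
  have hreidx : ∑ z : TorusSite 2 L, ((torusBand L z - μ : ℝ) : ℂ) • momentumNumber (-z) 1 =
      ∑ z : TorusSite 2 L, ((torusBand L z - μ : ℝ) : ℂ) • momentumNumber z 1 := by
    rw [← Equiv.sum_comp (Equiv.neg (TorusSite 2 L))]
    refine Finset.sum_congr rfl fun z _ => ?_
    simp only [Equiv.neg_apply, neg_neg, torusBand_neg]
  rw [FermionTorus.sum_eq_sum_torusSite]
  simp only [FermionTorus.toTorusSite_ofTorusSite, smul_add, Finset.sum_add_distrib, hreidx]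

/-! ### The partition function and the ground energy -/

/-- **BdG partition function of the free torus with a pair source of form factor `g`** (`L ≥ 3`):
`Re Tr e^{-β(K_μ - h(Δ_g + Δ_g†))} = 2^{2L²} Π_k e^{-βξ_k} (1 + cosh(β√(ξ_k² + h²w_g(k)²)))/2`.
[folklore] -/
theorem partitionFn_sourcedFreeTorus_re (hL : 3 ≤ L) (g : Site 2 → ℝ) (β μ h : ℝ) :
    (partitionFn β (hubbardTorusWith 2 L 1 0 μ - (h : ℂ) • (pairField g L + (pairField g L)ᴴ))).re =
      (2 : ℝ) ^ Fintype.card (Orb (FermionTorus 2 L)) *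
        ∏ k : TorusSite 2 L, (Real.exp (-(β * (torusBand L k - μ))) *
          ((1 + Real.cosh (β * Real.sqrt ((torusBand L k - μ) ^ 2 +
            (h * pairFieldMode g L k) ^ 2))) / 2)) := by
  obtain ⟨W, W', h1, hconj⟩ := exists_conj_onSiteBdG_eq_sourcedFreeTorus hL g μ h
  have hZ : partitionFn β (hubbardTorusWith 2 L 1 0 μ - (h : ℂ) • (pairField g L + (pairField g L)ᴴ)) =
      (2 : ℂ) ^ Fintype.card (Orb (FermionTorus 2 L)) *
        ∏ k : TorusSite 2 L, ((Real.exp (-(β * (torusBand L k - μ))) *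
          ((1 + Real.cosh (β * Real.sqrt ((torusBand L k - μ) ^ 2 +
            (h * pairFieldMode g L k) ^ 2))) / 2) : ℝ) : ℂ) := by
    rw [← hconj, partitionFn_conj_of_mul_eq_one h1]
    have key := trace_exp_neg_smul_sum_onSiteBdG (Λ := FermionTorus 2 L)
      (fun x => torusBand L x.toTorusSite - μ) (fun x => h * pairFieldMode g L x.toTorusSite) β Finset.univ
    have hprod : ∀ f : TorusSite 2 L → ℂ,
        ∏ x : FermionTorus 2 L, f x.toTorusSite = ∏ k : TorusSite 2 L, f k := fun f =>
      Fintype.prod_equiv FermionTorus.equivTorusSite _ _ fun _ => rfl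
    rw [hprod (fun k => ((Real.exp (-(β * (torusBand L k - μ))) *
          ((1 + Real.cosh (β * Real.sqrt ((torusBand L k - μ) ^ 2 +
            (h * pairFieldMode g L k) ^ 2))) / 2) : ℝ) : ℂ))] at key
    rw [partitionFn, gibbsWeight]
    convert key using 4
  rw [hZ, ← Complex.ofReal_prod]
  have h2 : (2 : ℂ) ^ Fintype.card (Orb (FermionTorus 2 L)) =
      (((2 : ℝ) ^ Fintype.card (Orb (FermionTorus 2 L)) : ℝ) : ℂ) := by
    push_cast; rfl
  rw [h2, ← Complex.ofReal_mul, Complex.ofReal_re]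

/-- `K_μ - h(Δ_g + Δ_g†)` is Hermitian (`h` real). [folklore] -/
theorem isHermitian_sourcedFreeTorus (g : Site 2 → ℝ) (μ h : ℝ) :
    (hubbardTorusWith 2 L 1 0 μ - (h : ℂ) • (pairField g L + (pairField g L)ᴴ)).IsHermitian := by
  refine (isHermitian_hubbardTorusWith L 1 0 μ).sub (IsHermitian.smul (isHermitian_add_transpose_self _) ?_)
  rw [isSelfAdjoint_iff, Complex.star_def, Complex.conj_ofReal]

/-- **The BdG ground-energy bound**: for `L ≥ 3` and every real form factor `g`,
`Σ_k (ξ_k - √(ξ_k² + h²w_g(k)²)) ≤ E₀(K_μ - h(Δ_g + Δ_g†))` — from `e^{-βE₀} ≤ Re Z_β`, the closed form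
of `Z_β` and `(1 + cosh y)/2 ≤ e^y`, letting `β → ∞`. (Equality holds — the Bogoliubov vacuum — but only
the lower bound is needed and proved.) [folklore] -/
theorem sum_bdgLevel_le_groundEnergy_sourcedFreeTorus (hL : 3 ≤ L) (g : Site 2 → ℝ) (μ h : ℝ) :
    ∑ k : TorusSite 2 L, ((torusBand L k - μ) -
        Real.sqrt ((torusBand L k - μ) ^ 2 + (h * pairFieldMode g L k) ^ 2)) ≤
      (hubbardTorusWith 2 L 1 0 μ - (h : ℂ) • (pairField g L + (pairField g L)ᴴ)).groundEnergy := by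
  set H := hubbardTorusWith 2 L 1 0 μ - (h : ℂ) • (pairField g L + (pairField g L)ᴴ) with hH
  set S := ∑ k : TorusSite 2 L, ((torusBand L k - μ) -
        Real.sqrt ((torusBand L k - μ) ^ 2 + (h * pairFieldMode g L k) ^ 2)) with hS
  have hHerm : H.IsHermitian := isHermitian_sourcedFreeTorus g μ h
  have key : ∀ β : ℝ, 0 < β → S - 2 * (L : ℝ) ^ 2 * Real.log 2 / β ≤ H.groundEnergy := by
    intro β hβ
    have h1 := exp_neg_mul_groundEnergy_le_partitionFn hHerm β
    have hZ := partitionFn_sourcedFreeTorus_re hL g β μ h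
    rw [← hH] at hZ
    -- bound each factor by `exp(-βξ_k) exp(βE_k)`
    have hfac : ∀ k : TorusSite 2 L, Real.exp (-(β * (torusBand L k - μ))) *
        ((1 + Real.cosh (β * Real.sqrt ((torusBand L k - μ) ^ 2 + (h * pairFieldMode g L k) ^ 2))) / 2) ≤
        Real.exp (-(β * ((torusBand L k - μ) -
          Real.sqrt ((torusBand L k - μ) ^ 2 + (h * pairFieldMode g L k) ^ 2)))) := by
      intro k
      have hy : 0 ≤ β * Real.sqrt ((torusBand L k - μ) ^ 2 + (h * pairFieldMode g L k) ^ 2) :=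
        mul_nonneg hβ.le (Real.sqrt_nonneg _)
      have hc := one_add_cosh_div_two_le_exp hy
      calc Real.exp (-(β * (torusBand L k - μ))) *
            ((1 + Real.cosh (β * Real.sqrt ((torusBand L k - μ) ^ 2 + (h * pairFieldMode g L k) ^ 2))) / 2)
          ≤ Real.exp (-(β * (torusBand L k - μ))) *
            Real.exp (β * Real.sqrt ((torusBand L k - μ) ^ 2 + (h * pairFieldMode g L k) ^ 2)) :=
            mul_le_mul_of_nonneg_left hc (Real.exp_pos _).le
        _ = _ := by rw [← Real.exp_add]; ring_nf
    have hfac_pos : ∀ k : TorusSite 2 L, 0 ≤ Real.exp (-(β * (torusBand L k - μ))) *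
        ((1 + Real.cosh (β * Real.sqrt ((torusBand L k - μ) ^ 2 + (h * pairFieldMode g L k) ^ 2))) / 2) := by
      intro k
      have := Real.one_le_cosh (β * Real.sqrt ((torusBand L k - μ) ^ 2 + (h * pairFieldMode g L k) ^ 2))
      positivity
    have hprod : ∏ k : TorusSite 2 L, (Real.exp (-(β * (torusBand L k - μ))) *
        ((1 + Real.cosh (β * Real.sqrt ((torusBand L k - μ) ^ 2 + (h * pairFieldMode g L k) ^ 2))) / 2)) ≤
        Real.exp (-(β * S)) := by
      calc ∏ k : TorusSite 2 L, (Real.exp (-(β * (torusBand L k - μ))) *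
            ((1 + Real.cosh (β * Real.sqrt ((torusBand L k - μ) ^ 2 + (h * pairFieldMode g L k) ^ 2))) / 2))
          ≤ ∏ k : TorusSite 2 L, Real.exp (-(β * ((torusBand L k - μ) -
              Real.sqrt ((torusBand L k - μ) ^ 2 + (h * pairFieldMode g L k) ^ 2)))) :=
            Finset.prod_le_prod (fun k _ => hfac_pos k) fun k _ => hfac k
        _ = Real.exp (-(β * S)) := by
            rw [← Real.exp_sum, hS, Finset.mul_sum, ← Finset.sum_neg_distrib]
    have hpow : (0 : ℝ) < (2 : ℝ) ^ Fintype.card (Orb (FermionTorus 2 L)) := by positivity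
    have h3 : Real.exp (-(β * H.groundEnergy)) ≤
        (2 : ℝ) ^ Fintype.card (Orb (FermionTorus 2 L)) * Real.exp (-(β * S)) := by
      calc Real.exp (-(β * H.groundEnergy)) ≤ (partitionFn β H).re := h1
        _ = _ := hZ
        _ ≤ _ := mul_le_mul_of_nonneg_left hprod hpow.le
    have h4 := Real.log_le_log (Real.exp_pos _) h3
    rw [Real.log_mul hpow.ne' (Real.exp_pos _).ne', Real.log_exp, Real.log_exp, Real.log_pow,
      card_orb_fermionTorus_two] at h4
    push_cast at h4
    have h5 : β * S - 2 * (L : ℝ) ^ 2 * Real.log 2 ≤ β * H.groundEnergy := by nlinarith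
    have h6 : (β * S - 2 * (L : ℝ) ^ 2 * Real.log 2) / β ≤ H.groundEnergy := by
      rw [div_le_iff₀ hβ]; linarith
    calc S - 2 * (L : ℝ) ^ 2 * Real.log 2 / β = (β * S - 2 * (L : ℝ) ^ 2 * Real.log 2) / β := by
          field_simp
      _ ≤ H.groundEnergy := h6
  have hc : 0 ≤ 2 * (L : ℝ) ^ 2 * Real.log 2 := by
    have := Real.log_nonneg (show (1 : ℝ) ≤ 2 by norm_num); positivity
  refine le_of_forall_pos_le_add fun ε hε => ?_
  obtain h := key ((2 * (L : ℝ) ^ 2 * Real.log 2 + 1) / ε) (by positivity)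
  have : 2 * (L : ℝ) ^ 2 * Real.log 2 / ((2 * (L : ℝ) ^ 2 * Real.log 2 + 1) / ε) ≤ ε := by
    rw [div_div_eq_mul_div, div_le_iff₀ (by positivity)]
    nlinarith
  linarith

/-- **BdG lower bound for the sourced free gas, on all of Fock space**: for `L ≥ 3`, every real form
factor `g`, all real `μ, h` and every unit vector `φ`,
`Σ_k (ξ_k - √(ξ_k² + h²w_g(k)²)) ≤ Re ⟨φ, (K_μ - h(Δ_g + Δ_g†)) φ⟩`. [folklore] -/
theorem sum_bdgLevel_le_re_rayleigh_sourcedFreeTorus (hL : 3 ≤ L) (g : Site 2 → ℝ) (μ h : ℝ)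
    (φ : Fock (Orb (FermionTorus 2 L))) (hφ : star φ ⬝ᵥ φ = 1) :
    ∑ k : TorusSite 2 L, ((torusBand L k - μ) -
        Real.sqrt ((torusBand L k - μ) ^ 2 + (h * pairFieldMode g L k) ^ 2)) ≤
      (star φ ⬝ᵥ (hubbardTorusWith 2 L 1 0 μ - (h : ℂ) • (pairField g L + (pairField g L)ᴴ)) *ᵥ φ).re :=
  (sum_bdgLevel_le_groundEnergy_sourcedFreeTorus hL g μ h).trans
    (Matrix.groundEnergy_le_rayleigh_holds (isHermitian_sourcedFreeTorus g μ h) φ hφ)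

end Summit.HubbardSuperconductivity.HubbardSuperconductivity.Theorems

end
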